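import Summits.Ventures.PercRepro.ProfileTwoAverage
import Summits.Ventures.PercRepro.ChooseThreeBound

/-!
# PercRepro — THE ROW `q = 3` OF (Π): THE COLOOP-FREE FAT SETS ARE PAID BY THEIR OWN RANK-`u` SETS
(p10, gen 5; `proofs/P10-Q3-INDEP.md` §5, piece (P2))

A rank-3 set `B` without coloops (hence with `≥ 4` points) and an independent `(u−3)`-set `Y` of the contraction
`M / B` give the rank-`u` set `S = B ∪ Y` whose coloops are exactly `Y` and whose non-coloops form `B` — so
`(B, Y) ↦ B ∪ Y` is injective (Theorem B's injection of `ProfileTwoFat`, on rank-3 cores), and the price of `B`,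
`C(ρ(E∖B), u−3) / C(u,3) ≤ C(R, u−3) / C(u,3) ≤ C(R−3, u−3)` (`ChooseThreeBound`), is at most the number of
independent `(u−3)`-sets of `M / B` (the subsets of a basis).  Hence the demand of the coloop-free fat rank-3
sets is at most `C(u,3)` times the number of rank-`u` sets with exactly `u−3` coloops whose non-coloops form a
coloop-free rank-3 set (`aSets`).

* `fat3cf` — the coloop-free rank-3 sets;  `aSets` — the rank-`u` sets `K ⊔ B` (`K` the `u−3` coloops, `B ∈ fat3cf`);
* `mem_clF_erase_of_mem_fat3cf` — a point of a coloop-free set lies in the closure of the others;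
* `coloops_union_eq3` — `B ∪ Y ∈ aSets` and `coloops (B ∪ Y) = Y`;
* `fatTriples`, `card_fatTriples`, `card_fatTriples_le_card_aSets` — the injection;
* **`fat3cf_demand_le_choose_mul_card_aSets`** — the bound.
-/

open scoped Matroid

namespace PercRepro.Cogirth

open Finset ThmH Skew Shadow Profile

variable {α : Type} [DecidableEq α] {M : Matroid α} [M.Finite] {u : ℕ}

open Classical in
/-- The coloop-free rank-3 subsets of the ground set (they have at least four points). -/
noncomputable def fat3cf (M : Matroid α) [M.Finite] : Finset (Finset α) :=
  (Rq M 3).filter (fun B => coloops M B = ∅)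

open Classical in
/-- Membership in `fat3cf`. -/
theorem mem_fat3cf {B : Finset α} : B ∈ fat3cf M ↔ B ∈ Rq M 3 ∧ coloops M B = ∅ := by
  unfold fat3cf
  rw [mem_filter]

open Classical in
/-- The rank-`u` sets with exactly `u − 3` coloops whose non-coloops form a coloop-free rank-3 set. -/
noncomputable def aSets (M : Matroid α) [M.Finite] (u : ℕ) : Finset (Finset α) :=
  (gr M).powerset.filter (fun S => rk M S = u ∧ (coloops M S).card = u - 3 ∧ S \ coloops M S ∈ fat3cf M)

open Classical in
/-- Membership in `aSets`. -/
theorem mem_aSets {S : Finset α} :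
    S ∈ aSets M u ↔ S ⊆ gr M ∧ rk M S = u ∧ (coloops M S).card = u - 3 ∧ S \ coloops M S ∈ fat3cf M := by
  unfold aSets
  rw [mem_filter, mem_powerset]

/-- A point of a coloop-free set lies in the closure of the other points. -/
theorem mem_clF_erase_of_mem_fat3cf {B : Finset α} (hB : B ∈ fat3cf M) {z : α} (hz : z ∈ B) :
    z ∈ clF M (B.erase z) := by
  by_contra h
  have : z ∈ coloops M B := mem_coloops.2 ⟨hz, h⟩
  rw [(mem_fat3cf.1 hB).2] at this
  exact absurd this (notMem_empty z)

/-- For `B` coloop-free of rank 3 and `Y` an independent `(u−3)`-set of `M / B`: `B ∪ Y ∈ aSets M u` and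
`coloops M (B ∪ Y) = Y`. -/
theorem coloops_union_eq3 (hu : 3 ≤ u) {B : Finset α} (hB : B ∈ fat3cf M) {Y : Finset α}
    (hY : Y ∈ indepSets (M ／ (B : Set α)) (u - 3)) :
    B ∪ Y ∈ aSets M u ∧ coloops M (B ∪ Y) = Y := by
  have hBg : B ⊆ gr M := (mem_Rq.1 (mem_fat3cf.1 hB).1).1
  have hrkB : rk M B = 3 := rk_eq_of_mem_Rq (mem_fat3cf.1 hB).1
  rw [mem_indepSets, gr_contract_finset] at hY
  obtain ⟨hYg, hYc, hYi⟩ := hY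
  have hYB : Disjoint Y B := disjoint_of_subset_left hYg sdiff_disjoint
  have hSg : B ∪ Y ⊆ gr M := union_subset hBg (hYg.trans sdiff_subset)
  have hrkY : rk (M ／ (B : Set α)) Y = u - 3 := by
    rw [rk_eq_card_of_indep hYi, hYc]
  have hrkS : rk M (B ∪ Y) = u := by
    have h := rk_contract_add_rk hBg hYg
    rw [hrkY, hrkB, union_comm] at h
    omega
  have hrk_sub : ∀ Y' ⊆ Y, rk M (B ∪ Y') = 3 + Y'.card := by
    intro Y' hY'
    have hY'i : (M ／ (B : Set α)).Indep (Y' : Set α) := hYi.subset (by exact_mod_cast hY')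
    have h := rk_contract_add_rk hBg (hY'.trans hYg)
    rw [rk_eq_card_of_indep hY'i, hrkB, union_comm] at h
    omega
  have hcol : coloops M (B ∪ Y) = Y := by
    ext z
    rw [mem_coloops]
    constructor
    · rintro ⟨hzS, hzcl⟩
      rw [mem_union] at hzS
      rcases hzS with hzB | hzY
      · exfalso
        apply hzcl
        have hsub : B.erase z ⊆ (B ∪ Y).erase z := erase_subset_erase z subset_union_left
        have hz' := mem_clF_erase_of_mem_fat3cf hB hzB
        rw [← Finset.mem_coe, coe_clF] at hz' ⊢
        exact M.closure_subset_closure (by exact_mod_cast hsub) hz'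
      · exact hzY
    · intro hzY
      have hzS : z ∈ B ∪ Y := mem_union_right _ hzY
      refine ⟨hzS, fun hzcl => ?_⟩
      have hzB : z ∉ B := fun h => disjoint_left.1 hYB hzY h
      have herase : (B ∪ Y).erase z = B ∪ Y.erase z := by
        ext x
        simp only [mem_erase, mem_union]
        constructor
        · rintro ⟨hxz, hx | hx⟩
          · exact Or.inl hx
          · exact Or.inr ⟨hxz, hx⟩
        · rintro (hx | ⟨hxz, hx⟩)
          · exact ⟨fun hxz => hzB (hxz ▸ hx), Or.inl hx⟩
          · exact ⟨hxz, Or.inr hx⟩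
      have hYpos : 0 < Y.card := card_pos.2 ⟨z, hzY⟩
      have hrk1 : rk M ((B ∪ Y).erase z) = 3 + (Y.card - 1) := by
        rw [herase, hrk_sub _ (erase_subset z Y), card_erase_of_mem hzY]
      have h := rk_insert_eq (M := M) (hSg hzS) ((erase_subset z _).trans hSg)
      rw [insert_erase hzS, hrkS, if_pos hzcl, hrk1] at h
      omega
  refine ⟨?_, hcol⟩
  rw [mem_aSets, hcol]
  refine ⟨hSg, hrkS, hYc, ?_⟩
  rw [union_sdiff_cancel_right hYB.symm]
  exact hB

/-- The pairs `(B, Y)`: a coloop-free rank-3 set `B` with an independent `(u−3)`-set of `M / B`. -/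
noncomputable def fatTriples (M : Matroid α) [M.Finite] (u : ℕ) : Finset (Σ _ : Finset α, Finset α) :=
  (fat3cf M).sigma (fun B => indepSets (M ／ (B : Set α)) (u - 3))

/-- `#fatTriples = Σ_B I_{u−3}(M / B)`. -/
theorem card_fatTriples (u : ℕ) :
    (fatTriples M u).card = ∑ B ∈ fat3cf M, (indepSets (M ／ (B : Set α)) (u - 3)).card := by
  unfold fatTriples
  exact card_sigma _ _

/-- `(B, Y) ↦ B ∪ Y` injects the pairs into `aSets M u`. -/
theorem card_fatTriples_le_card_aSets (hu : 3 ≤ u) : (fatTriples M u).card ≤ (aSets M u).card := by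
  apply card_le_card_of_injOn (fun p : Σ _ : Finset α, Finset α => p.1 ∪ p.2)
  · intro p hp
    rw [Finset.mem_coe, fatTriples, mem_sigma] at hp
    exact Finset.mem_coe.2 (coloops_union_eq3 hu hp.1 hp.2).1
  · intro p hp q hq h
    rw [Finset.mem_coe, fatTriples, mem_sigma] at hp hq
    simp only at h
    have hp' := coloops_union_eq3 hu hp.1 hp.2
    have hq' := coloops_union_eq3 hu hq.1 hq.2
    have hY : p.2 = q.2 := by rw [← hp'.2, ← hq'.2, h]
    have hdp : Disjoint p.2 p.1 := by
      have := (mem_indepSets.1 hp.2).1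
      rw [gr_contract_finset] at this
      exact disjoint_of_subset_left this sdiff_disjoint
    have hdq : Disjoint q.2 q.1 := by
      have := (mem_indepSets.1 hq.2).1
      rw [gr_contract_finset] at this
      exact disjoint_of_subset_left this sdiff_disjoint
    have hB : p.1 = q.1 := by
      rw [← union_sdiff_cancel_right hdp.symm, ← union_sdiff_cancel_right hdq.symm, h, hY]
    exact Sigma.ext hB (heq_of_eq hY)

/-- **The coloop-free fat rank-3 sets are paid by `aSets`**: `Σ_{B ∈ fat3cf} d_B ≤ C(u,3) · #aSets M u` for
`3 ≤ u ≤ ρ(E)`. -/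
theorem fat3cf_demand_le_choose_mul_card_aSets (hu : 3 ≤ u) (huR : u ≤ rk M (gr M)) :
    ∑ B ∈ fat3cf M, demand M 3 u B ≤ u.choose 3 * (aSets M u).card := by
  have hterm : ∀ B ∈ fat3cf M, demand M 3 u B ≤ u.choose 3 * (indepSets (M ／ (B : Set α)) (u - 3)).card := by
    intro B hB
    have hBg : B ⊆ gr M := (mem_Rq.1 (mem_fat3cf.1 hB).1).1
    have hrkB : rk M B = 3 := rk_eq_of_mem_Rq (mem_fat3cf.1 hB).1
    have hrk := rk_gr_contract_add_rk hBg
    rw [hrkB] at hrk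
    have hA := choose_rk_le_card_indepSets (M := M ／ (B : Set α)) (u - 3)
    have hrk' : rk (M ／ (B : Set α)) (gr (M ／ (B : Set α))) = rk M (gr M) - 3 := by omega
    rw [hrk'] at hA
    have hdem : demand M 3 u B ≤ (rk M (gr M)).choose (u - 3) := by
      unfold demand
      split_ifs with h
      · apply Nat.choose_le_choose
        exact rk_mono' (M := M) (sdiff_subset : gr M \ B ⊆ gr M)
      · exact Nat.zero_le _
    calc demand M 3 u B ≤ (rk M (gr M)).choose (u - 3) := hdem
      _ ≤ u.choose 3 * (rk M (gr M) - 3).choose (u - 3) := choose_le_choose_three_mul_choose hu huR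
      _ ≤ u.choose 3 * (indepSets (M ／ (B : Set α)) (u - 3)).card := Nat.mul_le_mul_left _ hA
  calc ∑ B ∈ fat3cf M, demand M 3 u B
      ≤ ∑ B ∈ fat3cf M, u.choose 3 * (indepSets (M ／ (B : Set α)) (u - 3)).card := sum_le_sum hterm
    _ = u.choose 3 * ∑ B ∈ fat3cf M, (indepSets (M ／ (B : Set α)) (u - 3)).card := by rw [mul_sum]
    _ = u.choose 3 * (fatTriples M u).card := by rw [card_fatTriples u]
    _ ≤ u.choose 3 * (aSets M u).card := Nat.mul_le_mul_left _ (card_fatTriples_le_card_aSets hu)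

end PercRepro.Cogirth
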